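import Mathlib
import HarnessLib
import Summits.Langlands.Langlands.Theses.QuadraticWindow
import Literature.NumberTheory.Automorphic.UnitaryCoherentGaloisRep
import Literature.NumberTheory.Automorphic.MokWeakBaseChange
import Literature.NumberTheory.GaloisRepresentations.GaloisRepOfAlgebraValuedLimit
import Summits.Langlands.Langlands.Theorems.QuadraticWindowGaloisRepOfUnitaryLDSAlmostAllUnramified

/-!
# Line `Sketch` (card `hecke-algebra-valued-limit`) — checked skeleton for the crux
`Summit.Langlands.Langlands.Theses.QuadraticWindow.GaloisRepOfUnitaryLDS` (stmt-Langlands-15129)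

The crux is VERBATIM the named fact `GoldringKoskivirta2019_galoisRep_unitary` (Goldring–Koskivirta
2019, Thm. 3.5.5, LDS unitary case, for Mok's quasi-split `U_{K/F₀}(N)`).  This line follows the
PRINTED proof (op. cit. §11.1, arXiv:1507.05032 p. 40): the Hecke eigensystem of `σ` modulo `ℓ^m`
factors through the `ℤ_ℓ`-Hecke ALGEBRA of cusp forms of a REGULAR weight at the same
(`ℓ`-hyperspecial) level (Thm. 3.4.1 "reduction to `H^0`" + Cor. 3.4.2 + §10), that algebra carries
the pseudo-representation induced by the Galois representations of regular discrete-series forms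
([HLTT] Cor. 1.3), and the `𝔭`-adic system `θ_m ∘ R` of pseudo-representations converges to the
trace of the wanted semisimple `r` (Taylor 1991).  The Galois half is isolated as ONE theorem of pure
`ℓ`-adic analysis — the ALGEBRA-VALUED limit theorem `stub_algebraValuedLimit` (per precision `m`, a
FINITE FAMILY of representations and one factorisation inequality replace the single approximant of
the tree's `exists_semisimple_galoisRep_of_ladicLimit`) — which the lead proves in this line; the
automorphic half is the congruence statement `stub_regularShadows` (GK Thm. 3.4.1/10.5 rendered as
that inequality, no Galois object in it) plus the REGULAR case of the crux `stub_regularDSGalois`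
(the crux with `d.IsRegular` added: [HLTT] Cor. 1.3) and two bookkeeping inputs of §11.1
(`stub_heckeFieldFinite`: Cor. 2.2.2, the eigenvalues of `σ` generate a finite `E/ℚ_ℓ`;
`stub_almostAllUnramified`: Flath, the bad set is finite).  Satake multiplicity one for `σ` is NOT a
stub: the composition derives the independence of the predicted polynomial from the choice of the
base-change parameter `β` by running the construction twice and comparing the two semisimple
representations on a dense set of Frobenii (continuity of characteristic polynomials).

Registered stubs (all signatures fully unfolded over tree vocabulary; no new definition) — state
after the wave-1 reshape:
* P2 is now the named fact `GoldringKoskivirta2019_heckeFieldFinite` (GK §11.1 "after replacing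
  `𝒪_𝔭` by a finite extension", with Cor. 2.2.2), relocated to
  `Literature/NumberTheory/Automorphic/UnitaryCoherentGaloisRep.lean` by the gate (p97966, accepted);
* `stub_almostAllUnramified` (P3; conditional on the named fact `Mok2014_weakBaseChange` + the proved
  `GL_N` Flath theorem; needs `[K:F₀] = 2`, `cK ≠ 1`) — CLOSED (p101470)
* `stub_regularDSGalois`    (K2, in print: [HLTT] Cor. 1.3 + Fakhruddin–Pilloni proof of 9.11 for
  `U → GU`; literally the crux restricted to regular `d`)
* `stub_regularShadows`     (K1, THE ENGINE, in print: GK Thm. 3.4.1, Cor. 3.4.2, §10, Cor. 2.2.2,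
  §11.1 first half; Pilloni–Stroh 2016 for `ℓ = 2`, `N` even)
* `stub_algebraValuedLimit` (K3, pure Galois side) — CLOSED by the lead:
  `Literature.NumberTheory.GaloisRepresentations.exists_semisimple_galoisRep_of_algebraValuedLimit`,
  Literature/NumberTheory/GaloisRepresentations/GaloisRepOfAlgebraValuedLimit.lean (p98575, accepted)
* the two named facts as stubs `stub_heckeFieldFinite : GoldringKoskivirta2019_heckeFieldFinite` and
  `stub_mokWeakBaseChange : Mok2014_weakBaseChange` (open debt = their `_holds`),
and `GaloisRepOfUnitaryLDS_of : GaloisRepOfUnitaryLDS`, proved here from the stubs.  REMAINING `sorry`s =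
exactly the four NAMED PRINT FACTS (P2, Mok, K2 = `HarrisLanTaylorThorne2016_galoisRep_unitary_discreteSeries`,
K1 = `GoldringKoskivirta2019_regularShadows`); everything on the Galois side is proved.
-/

noncomputable section

open scoped BigOperators Polynomial Classical NumberField
open Polynomial IsDedekindDomain NumberField Filter Topology
open Literature.NumberTheory.Automorphic Literature.NumberTheory.GaloisRepresentations

set_option linter.dupNamespace false

namespace Summit.Langlands.Langlands.Cruxes.GaloisRepOfUnitaryLDS.HeckeAlgebraValuedLimit

/-! ## The registered stubs -/

/-- **P2 (rationality of the eigenvalues of `σ`) — a NAMED FACT as stub.**  The predicted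
Frobenius polynomials of `σ` at its good places have coefficients in one finite `E/ℚ_ℓ`
(Goldring–Koskivirta 2019 §11.1 "after replacing `𝒪_𝔭` by a finite extension", with Cor. 2.2.2);
stated verbatim as (= the body of) the Literature fact `GoldringKoskivirta2019_heckeFieldFinite`
(relocated by the gate from this line's wave 1, p97966; restored p104061 after a relocation race).
Open debt: its `_holds`. -/
theorem stub_heckeFieldFinite : GoldringKoskivirta2019_heckeFieldFinite := by
  -- OPEN: named print fact (Literature def, accepted p97966 / restored p104061); debt = its `_holds`
  sorry

/-- **Input of P3 — a NAMED FACT as stub.**  Mok 2015, Cor. 4.3.8: weak base change of cuspidal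
representations of `U_{K/F₀}(N)` to `GL_N/K` (a.e. Satake form), the tree's named fact
`Mok2014_weakBaseChange`; with the proved `GL_N` Flath theorem it gives "σ is unramified at almost
every place", the automorphic half of P3.  Open debt: its `_holds` (shared with other lines of the
route). -/
theorem stub_mokWeakBaseChange : Mok2014_weakBaseChange := by
  sorry

/-- **P3 (the bad set is finite).**  For `σ` cuspidal on `U_{K/F₀}(N)` the set of finite places `u`
of `K` which are NOT good for the crux's conclusion — `u ∣ ℓ`, or some place `u'` over the same
rational prime is ramified over `ℚ` or `σ` is not hyperspecial-unramified at `u'` — is finite.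
In print: finitely many rational primes ramify in `K`; `σ = ⊗' σ_v` is `K_v`-spherical for almost
all `v` (Flath 1979, Thm. 3; Borel–Jacquet 1979, §4.6) and a spherical `σ_v` at a hyperspecial `K_v`
has a Satake parameter, whose standard base change is the base-change Satake parameter
(Cartier 1979 §IV, Mínguez 2011 Thm. 4.1).  RESHAPED (wave 1, worker reply `stub-misstated`): the
automorphic half is taken from the named fact `Mok2014_weakBaseChange` (Mok 2015 Cor. 4.3.8, a.e.
base change to `GL_N`) and the PROVED Flath theorem for `GL_N`
(`AutomorphicRepData.hasSatakeParamAt_cofinite_holds`), which need `[K:F₀] = 2` and `cK ≠ 1`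
(supplied by the crux); `N = 0` is proved outright. -/
theorem stub_almostAllUnramified : Mok2014_weakBaseChange →
    ∀ (F₀ K : Type) [Field F₀] [NumberField F₀] [Field K] [NumberField K] [Algebra F₀ K]
      (cK : K ≃ₐ[F₀] K), Module.finrank F₀ K = 2 → cK ≠ 1 → ∀ (N : ℕ) (ℓ : ℕ) [Fact ℓ.Prime]
      (hcptK : isCompact_glFiniteIntegralLevel N K)
      (σ : UnitaryGroup.CuspidalAutomorphicRepData F₀ K cK N hcptK),
      {u : HeightOneSpectrum (𝓞 K) | ¬ (((ℓ : ℕ) : 𝓞 K) ∉ u.asIdeal ∧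
        ∀ u' : HeightOneSpectrum (𝓞 K), u'.asIdeal.under ℤ = u.asIdeal.under ℤ →
          u'.asIdeal.ramificationIdx ℤ = 1 ∧
            UnitaryGroup.IsUnramifiedAt F₀ K cK N hcptK σ.1 u')}.Finite :=
  -- CLOSED (wave 1, p101470): Theorems/QuadraticWindowGaloisRepOfUnitaryLDSAlmostAllUnramified.lean
  Summit.Langlands.Langlands.Theorems.GaloisRepOfUnitaryLDS.HeckeAlgebraValuedLimit.stub_almostAllUnramified

/-- **K2 (the REGULAR case of the crux).**  Verbatim the crux `GaloisRepOfUnitaryLDS` with the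
archimedean hypothesis strengthened from "non-degenerate limit of discrete series" to "discrete
series" (`d.IsRegular`): Galois representations attached to cuspidal `σ'` on `U_{K/F₀}(N)` with
discrete series at every real place, `ℓ ∉ Ram(G) ∪ Ram(σ')`, with the predicted characteristic
polynomial at every good place.  In print: Harris–Lan–Taylor–Thorne 2016, Cor. 1.3 (= Shin 2011 +
Labesse base change + Clozel–Harris–Labesse), as used in Goldring–Koskivirta 2019 §11.1 (Rem. 11.1.1:
only discrete series of sufficiently regular parameter are needed), with the passage `U → GU` of
Fakhruddin–Pilloni 2021, proof of Thm. 9.11. -/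
theorem stub_regularDSGalois : HarrisLanTaylorThorne2016_galoisRep_unitary_discreteSeries := by
  -- OPEN: named print fact (Literature def, accepted p98266) = the crux with `d.IsRegular` added; debt = its `_holds`
  sorry

/-- **K1 (THE ENGINE: regular shadows — the eigensystem of `σ` modulo `ℓ^m` factors through the
Hecke ALGEBRA of regular discrete-series cusp forms).**  For `σ` as in the crux, a selection `β₀` of
base-change Satake parameters of `σ` at its good places and every precision `m`, there are finitely
many cuspidal `σ'_j` (`j < r`) on the SAME group `U_{K/F₀}(N)` with REGULAR discrete series at every
real place (`d.IsRegular`), hyperspecial-unramified above `ℓ`, good wherever `σ` is good, with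
selections `β'_j` of their base-change Satake parameters there, and a `δ > 0`, such that every
INTEGER polynomial `Φ` in the predicted Frobenius coefficients at good places which is `δ`-small on
all the `σ'_j` is `ℓ^{-m}`-small on `σ`.  (Equivalently: on the closed `ℤ_ℓ`-algebra `T` generated by
the Frobenius data of the `σ'_j` — a regular-weight Hecke algebra — the eigensystem of `σ` is a
CONTINUOUS ring homomorphism `T → 𝒪/ℓ^m`.)  In print: Goldring–Koskivirta 2019, Thm. 3.4.1 and
Cor. 3.4.2 (reduction to `H^0`: the Hecke algebra of `H^i(Sh_K^tor ⊗ ℤ/p^n, V_η^sub)` is a quotient of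
that of `H^0` in the regular weights `η + aη_ω + kχ_η`, unconditional in the PEL case, Rem. 3.4.4),
§10 (Lemma "fact hecke", Cor. "surjective mod `p^n`"), Thm. 2.2.1 + Cor. 2.2.2 (`σ` contributes to
`H^i(V_η^sub)`), §11.1 (eigenforms of `H^0` in those weights generate CUSPIDAL representations with
DISCRETE SERIES at infinity: Casselman–Osborne, Salamanca-Riba), all at a fixed `p`-hyperspecial
level `K`; `δ = ℓ^{-(m+e)}` with `ℓ^e` the exponent of the normalisation of the (finite, torsion-free)
regular-weight Hecke algebra.  Standing assumption `p > 2` there; `ℓ = 2` (admitted by the crux when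
`2` is unramified in `K` and `σ` unramified above `2`) is Pilloni–Stroh 2016, Cor. 3.13 (`N` even) /
Rem. 3.12.1 (`N` odd), exactly as for the crux itself. -/
theorem stub_regularShadows : GoldringKoskivirta2019_regularShadows := by
  -- OPEN: named print fact (Literature def, accepted p99073 / restored p105474), the ENGINE; debt = its `_holds`
  sorry

/-- **K3 (the algebra-valued `ℓ`-adic limit theorem; pure Galois side, the lever of the line).**
Taylor 1991 §1 / Goldring–Koskivirta 2019 §11.1 in its faithful, Hecke-ALGEBRA-valued form.  `K` a
number field, `E/ℚ_ℓ` finite, `S` a finite set of finite places, `P_v` (`v ∉ S`) prescribed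
polynomials with coefficients in `E`.  Suppose that for every `m` there are finitely many continuous
`ρ'_i : Γ_K → GL_n(ℚ̄_ℓ)` (`i < r`), unramified at every `v ∉ S`, `v ∤ ℓ`, with Frobenius
characteristic polynomials `Q_i v` there, and a `δ > 0`, such that every integer polynomial `F` in the
variables `X_{(v,k)}` (`v ∉ S`, `v ∤ ℓ`) with `‖F((Q_i v)_k)‖ ≤ δ` for all `i` satisfies
`‖F((P_v)_k)‖ ≤ ℓ^{-m}` — i.e. the prescription `v ↦ P_v` modulo `ℓ^m` is a continuous ring
homomorphism on the closed `ℤ_ℓ`-algebra generated by the Frobenius data of the `ρ'_i`.  Then there is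
a continuous SEMISIMPLE `ρ : Γ_K → GL_n(ℚ̄_ℓ)`, unramified at every `v ∉ S`, `v ∤ ℓ`, with
`charpoly ρ(Frob_v) = P_v`.  (The single-approximant theorem
`exists_semisimple_galoisRep_of_ladicLimit` is the case `r = 1`, `δ = ℓ^{-m}`.)  Proof in the line:
density of good Frobenii (Chebotarev), cells of the finite family's coefficient map, locally
constant interpolants, uniform limits in the complete `E`, transfer of integer-polynomial identities
(pseudocharacter identities, traces of powers) through the inequality, Taylor's theorem
(`BellaicheChenevier2009_continuous_rep_of_pseudocharacter_holds`), Newton's identities,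
unramifiedness by the characteristic-polynomial kernel. -/
theorem stub_algebraValuedLimit :
    ∀ (K : Type) [Field K] [NumberField K] (n ℓ : ℕ) [Fact ℓ.Prime]
      (E : IntermediateField ℚ_[ℓ] (PadicAlgCl ℓ)), FiniteDimensional ℚ_[ℓ] E →
      ∀ (S : Set (HeightOneSpectrum (𝓞 K))), S.Finite →
      ∀ (P : HeightOneSpectrum (𝓞 K) → (PadicAlgCl ℓ)[X]),
      (∀ v ∉ S, ∀ k : ℕ, (P v).coeff k ∈ E) →
      (∀ m : ℕ, ∃ (r : ℕ) (ρ' : Fin r → FramedGaloisRep K (PadicAlgCl ℓ) n)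
          (Q : Fin r → HeightOneSpectrum (𝓞 K) → (PadicAlgCl ℓ)[X]) (δ : ℝ), 0 < δ ∧
          (∀ i, ∀ v ∉ S, ((ℓ : ℕ) : 𝓞 K) ∉ v.asIdeal →
            (ρ' i).IsUnramifiedAt v ∧ (ρ' i).HasFrobCharpolyAt v (Q i v)) ∧
          ∀ F : MvPolynomial (HeightOneSpectrum (𝓞 K) × ℕ) ℤ,
            (∀ vk ∈ F.vars, vk.1 ∉ S ∧ ((ℓ : ℕ) : 𝓞 K) ∉ vk.1.asIdeal) →
            (∀ i, ‖MvPolynomial.aeval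
                (fun vk : HeightOneSpectrum (𝓞 K) × ℕ => (Q i vk.1).coeff vk.2) F‖ ≤ δ) →
              ‖MvPolynomial.aeval
                  (fun vk : HeightOneSpectrum (𝓞 K) × ℕ => (P vk.1).coeff vk.2) F‖ ≤
                (ℓ : ℝ) ^ (-(m : ℤ))) →
      ∃ ρ : FramedGaloisRep K (PadicAlgCl ℓ) n, ρ.toGaloisRep.IsSemisimple ∧
        ∀ v ∉ S, ((ℓ : ℕ) : 𝓞 K) ∉ v.asIdeal → ρ.IsUnramifiedAt v ∧ ρ.HasFrobCharpolyAt v (P v) :=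
  -- CLOSED by the lead (p98575): Literature/NumberTheory/GaloisRepresentations/GaloisRepOfAlgebraValuedLimit.lean
  exists_semisimple_galoisRep_of_algebraValuedLimit

/-! ## The composition -/

section Composition

variable {F₀ K : Type} [Field F₀] [NumberField F₀] [Field K] [NumberField K] [Algebra F₀ K]
  {cK : K ≃ₐ[F₀] K} {N ℓ : ℕ} [Fact ℓ.Prime]
  {hcptK : isCompact_glFiniteIntegralLevel N K}

/-- Two continuous framed Galois representations whose Frobenius characteristic polynomials agree
at every place outside a finite set have the same characteristic polynomial EVERYWHERE (Chebotarev
density of Frobenii, tree theorem `absoluteGaloisGroup.frobenius_dense`, and continuity of the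
coefficients of `g ↦ charpoly ρ(g)`). [folklore] -/
theorem charpoly_eq_of_frob_eq {n : ℕ} (r r' : FramedGaloisRep K (PadicAlgCl ℓ) n)
    (T : Set (HeightOneSpectrum (𝓞 K))) (hT : T.Finite)
    (h : ∀ v ∉ T, ∃ Pv : (PadicAlgCl ℓ)[X], r.HasFrobCharpolyAt v Pv ∧ r'.HasFrobCharpolyAt v Pv)
    (g : Field.absoluteGaloisGroup K) : FramedRep.charpoly r g = FramedRep.charpoly r' g := by
  have hD := absoluteGaloisGroup.frobenius_dense chebotarev_artinRep_holds K T hT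
  ext k
  have hc := LadicLimit.continuous_coeff_charpoly r k
  have hc' := LadicLimit.continuous_coeff_charpoly r' k
  refine congr_fun (Continuous.ext_on hD hc hc' ?_) g
  rintro φ ⟨v, hv, 𝔓, h𝔓, hφ⟩
  obtain ⟨Pv, hr, hr'⟩ := h v hv
  simp only [hr 𝔓 h𝔓 φ hφ, hr' 𝔓 h𝔓 φ hφ]

/-- The crux for ONE datum and ONE selection `β₀` of base-change Satake parameters at the good
places: the five stubs give a semisimple `r` with the predicted polynomial of `β₀ u` at every good
`u`.  (`S :=` the bad set, finite by P3; `P u :=` the predicted polynomial of `β₀ u`, `E`-rational by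
P2; the approximation families of K3 are the Galois representations (K2) of the regular shadows
(K1).) -/
theorem exists_rep_of_selection (ι : PadicAlgCl ℓ ≃+* ℂ) (hF₀ : IsTotallyReal F₀)
    (hK : Module.finrank F₀ K = 2) (hc : cK ≠ 1) (hKc : IsTotallyComplex K)
    (σ : UnitaryGroup.CuspidalAutomorphicRepData F₀ K cK N hcptK)
    (hLDS : ∀ (w : {w : InfinitePlace K // w.IsComplex}) (hw : cK • w.1 = w.1),
      ∃ (p q : ℕ) (d : LDSDatum p q),
        UnitaryGroup.IsNondegenerateLimitOfDiscreteSeriesAt F₀ K cK N (StdForm.antidiagonal N)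
          hcptK σ.1 hw hc d)
    (hℓ : ∀ u : HeightOneSpectrum (𝓞 K), ((ℓ : ℕ) : 𝓞 K) ∈ u.asIdeal →
      u.asIdeal.ramificationIdx ℤ = 1 ∧ UnitaryGroup.IsUnramifiedAt F₀ K cK N hcptK σ.1 u)
    (β₀ : HeightOneSpectrum (𝓞 K) → Multiset ℂ)
    (hβ₀ : ∀ u : HeightOneSpectrum (𝓞 K), ((ℓ : ℕ) : 𝓞 K) ∉ u.asIdeal →
      (∀ u' : HeightOneSpectrum (𝓞 K), u'.asIdeal.under ℤ = u.asIdeal.under ℤ →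
        u'.asIdeal.ramificationIdx ℤ = 1 ∧ UnitaryGroup.IsUnramifiedAt F₀ K cK N hcptK σ.1 u') →
      UnitaryGroup.HasBaseChangeSatakeAt F₀ K cK N hcptK σ.1 u (β₀ u)) :
    ∃ r : FramedGaloisRep K (PadicAlgCl ℓ) N, r.toGaloisRep.IsSemisimple ∧
      ∀ u : HeightOneSpectrum (𝓞 K), ((ℓ : ℕ) : 𝓞 K) ∉ u.asIdeal →
        (∀ u' : HeightOneSpectrum (𝓞 K), u'.asIdeal.under ℤ = u.asIdeal.under ℤ →
          u'.asIdeal.ramificationIdx ℤ = 1 ∧ UnitaryGroup.IsUnramifiedAt F₀ K cK N hcptK σ.1 u') →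
        r.IsUnramifiedAt u ∧ r.HasFrobCharpolyAt u (arithFrobPolyOfSatake ι u.residueCard N (β₀ u)) := by
  -- the bad set
  set S : Set (HeightOneSpectrum (𝓞 K)) := {u | ¬ (((ℓ : ℕ) : 𝓞 K) ∉ u.asIdeal ∧
    ∀ u' : HeightOneSpectrum (𝓞 K), u'.asIdeal.under ℤ = u.asIdeal.under ℤ →
      u'.asIdeal.ramificationIdx ℤ = 1 ∧ UnitaryGroup.IsUnramifiedAt F₀ K cK N hcptK σ.1 u')} with hSdef
  have hS : S.Finite := stub_almostAllUnramified stub_mokWeakBaseChange F₀ K cK hK hc N ℓ hcptK σ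
  have hmemS : ∀ u, u ∉ S ↔ (((ℓ : ℕ) : 𝓞 K) ∉ u.asIdeal ∧
      ∀ u' : HeightOneSpectrum (𝓞 K), u'.asIdeal.under ℤ = u.asIdeal.under ℤ →
        u'.asIdeal.ramificationIdx ℤ = 1 ∧ UnitaryGroup.IsUnramifiedAt F₀ K cK N hcptK σ.1 u') := by
    intro u; simp [hSdef]
  -- rationality
  obtain ⟨E, hEfd, hE⟩ := stub_heckeFieldFinite F₀ K cK hF₀ hK hc hKc N ℓ ι hcptK σ hLDS hℓ
  haveI := hEfd
  set P : HeightOneSpectrum (𝓞 K) → (PadicAlgCl ℓ)[X] :=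
    fun u => arithFrobPolyOfSatake ι u.residueCard N (β₀ u) with hPdef
  have hP : ∀ v ∉ S, ∀ k : ℕ, (P v).coeff k ∈ E := by
    intro v hv k
    obtain ⟨hvℓ, hv'⟩ := (hmemS v).1 hv
    exact hE v (β₀ v) hvℓ hv' (hβ₀ v hvℓ hv') k
  -- the approximation families: Galois representations (K2) of the regular shadows (K1)
  have happrox : ∀ m : ℕ, ∃ (r : ℕ) (ρ' : Fin r → FramedGaloisRep K (PadicAlgCl ℓ) N)
      (Q : Fin r → HeightOneSpectrum (𝓞 K) → (PadicAlgCl ℓ)[X]) (δ : ℝ), 0 < δ ∧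
      (∀ i, ∀ v ∉ S, ((ℓ : ℕ) : 𝓞 K) ∉ v.asIdeal →
        (ρ' i).IsUnramifiedAt v ∧ (ρ' i).HasFrobCharpolyAt v (Q i v)) ∧
      ∀ F : MvPolynomial (HeightOneSpectrum (𝓞 K) × ℕ) ℤ,
        (∀ vk ∈ F.vars, vk.1 ∉ S ∧ ((ℓ : ℕ) : 𝓞 K) ∉ vk.1.asIdeal) →
        (∀ i, ‖MvPolynomial.aeval
            (fun vk : HeightOneSpectrum (𝓞 K) × ℕ => (Q i vk.1).coeff vk.2) F‖ ≤ δ) →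
          ‖MvPolynomial.aeval
              (fun vk : HeightOneSpectrum (𝓞 K) × ℕ => (P vk.1).coeff vk.2) F‖ ≤
            (ℓ : ℝ) ^ (-(m : ℤ)) := by
    intro m
    obtain ⟨r, σ', β', δ, hδ, hfam, hineq⟩ :=
      stub_regularShadows F₀ K cK hF₀ hK hc hKc N ℓ ι hcptK σ hLDS hℓ β₀ hβ₀ m
    have hgal : ∀ j : Fin r, ∃ rj : FramedGaloisRep K (PadicAlgCl ℓ) N,
        ∀ v ∉ S, ((ℓ : ℕ) : 𝓞 K) ∉ v.asIdeal → rj.IsUnramifiedAt v ∧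
          rj.HasFrobCharpolyAt v (arithFrobPolyOfSatake ι v.residueCard N (β' j v)) := by
      intro j
      obtain ⟨hDS, hℓj, hgoodj⟩ := hfam j
      obtain ⟨rj, -, hrj⟩ :=
        stub_regularDSGalois F₀ K cK hF₀ hK hc hKc N ℓ ι hcptK (σ' j) hDS hℓj
      refine ⟨rj, fun v hv hvℓ => ?_⟩
      obtain ⟨-, hv'⟩ := (hmemS v).1 hv
      obtain ⟨hv'j, hβ'j⟩ := hgoodj v hvℓ hv'
      exact hrj v (β' j v) hvℓ hv'j hβ'j
    choose ρ' hρ' using hgal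
    refine ⟨r, ρ', fun j v => arithFrobPolyOfSatake ι v.residueCard N (β' j v), δ, hδ,
      fun j v hv hvℓ => hρ' j v hv hvℓ, fun F hF hFδ => ?_⟩
    exact hineq F (fun uk huk => (hmemS uk.1).1 (hF uk huk).1) hFδ
  obtain ⟨ρ, hss, hρ⟩ := stub_algebraValuedLimit K N ℓ E hEfd S hS P hP happrox
  refine ⟨ρ, hss, fun u hu hu' => ?_⟩
  exact hρ u ((hmemS u).2 ⟨hu, hu'⟩) hu

end Composition

/-- **Skeleton theorem: the crux BY NAME from the five stubs.**  Choose a selection `β₀` of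
base-change Satake parameters at the good places (they exist: a good place is in particular a place
where `σ` is unramified); `exists_rep_of_selection` gives `r`.  For an arbitrary parameter `β` at a
good `u`, run the construction again with the selection changed at `u` only; the two semisimple
representations have the same Frobenius polynomials at every OTHER good place, hence (density +
continuity, `charpoly_eq_of_frob_eq`) the same characteristic polynomial at a Frobenius of `u`, i.e.
the predicted polynomials of `β₀ u` and of `β` coincide. -/
theorem GaloisRepOfUnitaryLDS_of :
    Summit.Langlands.Langlands.Theses.QuadraticWindow.GaloisRepOfUnitaryLDS := by
  intro F₀ K _ _ _ _ _ cK hF₀ hK hc hKc N ℓ _ ι hcptK σ hLDS hℓ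
  classical
  -- a selection of base-change Satake parameters at the good places
  have hsel : ∀ u : HeightOneSpectrum (𝓞 K), ((ℓ : ℕ) : 𝓞 K) ∉ u.asIdeal →
      (∀ u' : HeightOneSpectrum (𝓞 K), u'.asIdeal.under ℤ = u.asIdeal.under ℤ →
        u'.asIdeal.ramificationIdx ℤ = 1 ∧ UnitaryGroup.IsUnramifiedAt F₀ K cK N hcptK σ.1 u') →
      ∃ β : Multiset ℂ, UnitaryGroup.HasBaseChangeSatakeAt F₀ K cK N hcptK σ.1 u β :=
    fun u _ hu' => (hu' u rfl).2
  let β₀ : HeightOneSpectrum (𝓞 K) → Multiset ℂ := fun u =>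
    if h : (((ℓ : ℕ) : 𝓞 K) ∉ u.asIdeal ∧
      ∀ u' : HeightOneSpectrum (𝓞 K), u'.asIdeal.under ℤ = u.asIdeal.under ℤ →
        u'.asIdeal.ramificationIdx ℤ = 1 ∧ UnitaryGroup.IsUnramifiedAt F₀ K cK N hcptK σ.1 u')
    then (hsel u h.1 h.2).choose else 0
  have hβ₀ : ∀ u : HeightOneSpectrum (𝓞 K), ((ℓ : ℕ) : 𝓞 K) ∉ u.asIdeal →
      (∀ u' : HeightOneSpectrum (𝓞 K), u'.asIdeal.under ℤ = u.asIdeal.under ℤ →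
        u'.asIdeal.ramificationIdx ℤ = 1 ∧ UnitaryGroup.IsUnramifiedAt F₀ K cK N hcptK σ.1 u') →
      UnitaryGroup.HasBaseChangeSatakeAt F₀ K cK N hcptK σ.1 u (β₀ u) := by
    intro u hu hu'
    simp only [β₀, dif_pos (And.intro hu hu')]
    exact (hsel u hu hu').choose_spec
  obtain ⟨r, hss, hr⟩ := exists_rep_of_selection ι hF₀ hK hc hKc σ hLDS hℓ β₀ hβ₀
  refine ⟨r, hss, fun u β hu hu' hβ => ⟨(hr u hu hu').1, ?_⟩⟩
  -- second run, with the selection changed at `u`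
  let β₁ : HeightOneSpectrum (𝓞 K) → Multiset ℂ := Function.update β₀ u β
  have hβ₁ : ∀ v : HeightOneSpectrum (𝓞 K), ((ℓ : ℕ) : 𝓞 K) ∉ v.asIdeal →
      (∀ u' : HeightOneSpectrum (𝓞 K), u'.asIdeal.under ℤ = v.asIdeal.under ℤ →
        u'.asIdeal.ramificationIdx ℤ = 1 ∧ UnitaryGroup.IsUnramifiedAt F₀ K cK N hcptK σ.1 u') →
      UnitaryGroup.HasBaseChangeSatakeAt F₀ K cK N hcptK σ.1 v (β₁ v) := by
    intro v hv hv'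
    by_cases hvu : v = u
    · subst hvu; simpa [β₁] using hβ
    · simpa [β₁, Function.update_of_ne hvu] using hβ₀ v hv hv'
  obtain ⟨r', -, hr'⟩ := exists_rep_of_selection ι hF₀ hK hc hKc σ hLDS hℓ β₁ hβ₁
  -- the two representations have the same Frobenius polynomials off the bad set and `u`
  set S : Set (HeightOneSpectrum (𝓞 K)) := {u | ¬ (((ℓ : ℕ) : 𝓞 K) ∉ u.asIdeal ∧
    ∀ u' : HeightOneSpectrum (𝓞 K), u'.asIdeal.under ℤ = u.asIdeal.under ℤ →
      u'.asIdeal.ramificationIdx ℤ = 1 ∧ UnitaryGroup.IsUnramifiedAt F₀ K cK N hcptK σ.1 u')} with hSdef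
  have hS : S.Finite := stub_almostAllUnramified stub_mokWeakBaseChange F₀ K cK hK hc N ℓ hcptK σ
  have heq : ∀ g, FramedRep.charpoly r g = FramedRep.charpoly r' g := by
    refine charpoly_eq_of_frob_eq r r' (S ∪ {u}) (hS.union (Set.finite_singleton u)) ?_
    intro v hv
    simp only [Set.mem_union, Set.mem_singleton_iff, not_or, hSdef, Set.mem_setOf_eq, not_not] at hv
    obtain ⟨⟨hvℓ, hv'⟩, hvu⟩ := hv
    refine ⟨arithFrobPolyOfSatake ι v.residueCard N (β₀ v), (hr v hvℓ hv').2, ?_⟩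
    have e : β₁ v = β₀ v := by simp [β₁, Function.update_of_ne hvu]
    simpa [e] using (hr' v hvℓ hv').2
  -- read off at a Frobenius of `u`
  obtain ⟨𝔓, h𝔓⟩ := HeightOneSpectrum.primesAbove_nonempty u
  obtain ⟨φ, hφ⟩ := HeightOneSpectrum.exists_isArithFrobAt_of_mem_primesAbove_holds h𝔓
  have h0 : FramedRep.charpoly r φ = arithFrobPolyOfSatake ι u.residueCard N (β₀ u) :=
    (hr u hu hu').2 𝔓 h𝔓 φ hφ
  have h1 : FramedRep.charpoly r' φ = arithFrobPolyOfSatake ι u.residueCard N β := by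
    have := (hr' u hu hu').2 𝔓 h𝔓 φ hφ
    simpa [β₁] using this
  have hpoly : arithFrobPolyOfSatake ι u.residueCard N β =
      arithFrobPolyOfSatake ι u.residueCard N (β₀ u) := by
    rw [← h1, ← heq φ, h0]
  rw [hpoly]
  exact (hr u hu hu').2

end Summit.Langlands.Langlands.Cruxes.GaloisRepOfUnitaryLDS.HeckeAlgebraValuedLimit

end
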